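import Mathlib
import Summits.MatrixMultiplication.MatrixMultiplication.Theses.OrbitHarmonicsHosts
import Summits.MatrixMultiplication.MatrixMultiplication.Theorems.OrbitHarmonicsHostsAbelianNoGoCore
import Summits.MatrixMultiplication.MatrixMultiplication.Theorems.OrbitHarmonicsHostsAbelianNoGoWeights
import Summits.MatrixMultiplication.MatrixMultiplication.Theorems.OrbitHarmonicsHostsAbelianNoGoDiag

/-!
# `AbelianNoGo` — abelian symmetry hosts nothing below `N³`

Route `MatrixMultiplication/OrbitHarmonicsHosts`, support item `stmt-MatrixMultiplication-5456`:
for a finite **abelian** group `Γ`, every `Γ`-equivariant hosting `γ(α(X)·β(Y)) = X·Y` of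
`⟨N,N,N⟩` in the orbit-harmonics ring `gr(Γ·v) = ℂ[x]/span LF(I(Γ·v))` of a free orbit has
`N³ ≤ |Γ|` (exact route signature `…Theses.OrbitHarmonicsHosts.AbelianNoGo`).

Proof (the route's sketch, Cohn–Umans-style injectivity).
1. `pow_three_le_card_of_diagonal` — the case of diagonal `ρ_P, ρ_Q, ρ_R` with eigencharacters
   `p, q, r : Fin N → Γ^`: then `α(E_st)` is a weight vector of weight `q_t/p_s` and `β(E_tu)`
   one of weight `r_u/q_t`, so modulo `J` they are multiples `a_st φ_{q_t/p_s}`,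
   `b_tu φ_{r_u/q_t}` of the homogeneous lifts `phi` (`Defs` file; **W** of the `Weights` file); matched products
   `γ(α(E_st)β(E_tu)) = E_su ≠ 0` force the levels to add
   (`ℓ(r_u/p_s) = ℓ(q_t/p_s) + ℓ(r_u/q_t)`, **M**) and pin down `γ(φ_{r_u/p_s}) ∈ ℂˣ E_su`
   (so `(s,u) ↦ r_u/p_s` is injective); a cross product `t₁ ≠ t₂` whose weight is an output
   weight must die in `gr`, i.e. is *not* additive in level; the combinatorial core
   (`psi_injective`, `Core` file) then makes `(s,t,u) ↦ q_t/(p_s r_u)` injective into the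
   characters of `Γ`, which are linearly independent functions on `Γ` (Dedekind), whence
   `N³ ≤ dim Fun(Γ) = |Γ|`.
2. `AbelianNoGo_proof` — the general case reduces to the diagonal one by simultaneously
   diagonalising `ρ_P, ρ_Q, ρ_R` (`exists_diagonalizer`, `Diag` file) and conjugating
   `α, β, γ` by the base-change matrices.
The `γ`-equivariance hypothesis of the route statement is not needed.
-/

-- single-conjunct summit: the mandated namespace repeats `MatrixMultiplication`.
set_option linter.dupNamespace false

namespace Summit.MatrixMultiplication.MatrixMultiplication.Theorems

namespace AbelianNoGo

open MvPolynomial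

variable {Γ : Type*} [CommGroup Γ] [Fintype Γ] {d N : ℕ}

/-- `diag d₁ · E_st(c) · diag d₂ = E_st(d₁ s · c · d₂ t)`. [folklore] -/
lemma diagonal_mul_single_mul_diagonal (d₁ d₂ : Fin N → ℂ) (s t : Fin N) (c : ℂ) :
    Matrix.diagonal d₁ * Matrix.single s t c * Matrix.diagonal d₂ =
      Matrix.single s t (d₁ s * c * d₂ t) := by
  ext i j
  rw [Matrix.mul_diagonal, Matrix.diagonal_mul, Matrix.single_apply, Matrix.single_apply]
  split_ifs with h
  · obtain ⟨rfl, rfl⟩ := h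
    rfl
  · ring

/-- **The diagonal case.** If `ρ_P, ρ_Q, ρ_R` are diagonal with eigencharacters `p, q, r`, i.e.
`α(E_st)` is a `subst`-weight vector of weight `q_t/p_s` and `β(E_tu)` one of weight `r_u/q_t`,
and `γ` kills `J` and hosts `γ(α(E_st) β(E_t'u)) = E_st E_t'u`, then `N³ ≤ |Γ|`. [folklore] -/
theorem pow_three_le_card_of_diagonal (ρV : Γ →* GL (Fin d) ℂ) (v : Fin d → ℂ)
    (hinj : Function.Injective (pt ρV v)) (p q r : Fin N → (Γ →* ℂˣ))
    (α β : Matrix (Fin N) (Fin N) ℂ → MvPolynomial (Fin d) ℂ)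
    (γ : MvPolynomial (Fin d) ℂ →ₗ[ℂ] Matrix (Fin N) (Fin N) ℂ)
    (hγ : ∀ f ∈ grIdeal ρV v, γ f = 0)
    (hhost : ∀ s t t' u, γ (α (Matrix.single s t 1) * β (Matrix.single t' u 1)) =
      Matrix.single s t 1 * Matrix.single t' u 1)
    (hα : ∀ g s t, subst ρV g (α (Matrix.single s t 1)) =
      fn (q t / p s) g • α (Matrix.single s t 1))
    (hβ : ∀ g t u, subst ρV g (β (Matrix.single t u 1)) =
      fn (r u / q t) g • β (Matrix.single t u 1)) :
    N ^ 3 ≤ Fintype.card Γ := by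
  classical
  -- `γ` only sees classes modulo `J`
  have hJ : ∀ f f' : MvPolynomial (Fin d) ℂ, f - f' ∈ grIdeal ρV v → γ f = γ f' := by
    intro f f' h
    have h0 := hγ _ h
    rwa [map_sub, sub_eq_zero] at h0
  -- (W): `α(E_st) ≡ a_st φ_{q_t/p_s}`, `β(E_tu) ≡ b_tu φ_{r_u/q_t}`
  have hαW : ∀ s t, ∃ a : ℂ,
      α (Matrix.single s t 1) - C a * phi ρV v (q t / p s) ∈ grIdeal ρV v :=
    fun s t => exists_sub_C_mul_phi_mem hinj (hα · s t)
  have hβW : ∀ t u, ∃ b : ℂ,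
      β (Matrix.single t u 1) - C b * phi ρV v (r u / q t) ∈ grIdeal ρV v :=
    fun t u => exists_sub_C_mul_phi_mem hinj (hβ · t u)
  choose a ha using hαW
  choose b hb using hβW
  -- products modulo `J`
  have hprod : ∀ s t t' u, γ (α (Matrix.single s t 1) * β (Matrix.single t' u 1)) =
      (a s t * b t' u) • γ (phi ρV v (q t / p s) * phi ρV v (r u / q t')) := by
    intro s t t' u
    rw [← map_smul, smul_eq_C_mul]
    apply hJ
    have h := Ideal.add_mem _ (Ideal.mul_mem_right (β (Matrix.single t' u 1)) _ (ha s t))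
      (Ideal.mul_mem_left _ (C (a s t) * phi ρV v (q t / p s)) (hb t' u))
    convert h using 1
    simp only [map_mul]
    ring
  have hAB : ∀ s t u, q t / p s * (r u / q t) = r u / p s := fun s t u =>
    MonoidHom.ext fun g => by
      simp only [MonoidHom.mul_apply, MonoidHom.div_apply]
      rw [mul_comm, div_mul_div_cancel]
  -- matched products: levels add, `a_st b_tu ≠ 0`, and `γ(φ_{r_u/p_s}) = (a_st b_tu)⁻¹ E_su`
  have hmatch : ∀ s t u,
      lev ρV v (r u / p s) = lev ρV v (q t / p s) + lev ρV v (r u / q t) ∧ a s t * b t u ≠ 0 ∧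
        γ (phi ρV v (r u / p s)) = (a s t * b t u)⁻¹ • Matrix.single s u 1 := by
    intro s t u
    have h1 : γ (α (Matrix.single s t 1) * β (Matrix.single t u 1)) = Matrix.single s u (1 : ℂ) := by
      rw [hhost, Matrix.single_mul_single_same, mul_one]
    have h2 := hprod s t t u
    rcases (lev_mul_le hinj (q t / p s) (r u / q t)).eq_or_lt with heq | hlt
    · have h3 : γ (phi ρV v (q t / p s) * phi ρV v (r u / q t)) = γ (phi ρV v (r u / p s)) := by
        apply hJ
        have h4 := phi_mul_sub_phi_mem hinj heq
        rwa [hAB] at h4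
      have key : Matrix.single s u (1 : ℂ) = (a s t * b t u) • γ (phi ρV v (r u / p s)) := by
        rw [← h1, h2, h3]
      have hab : a s t * b t u ≠ 0 := by
        intro h0
        rw [h0, zero_smul] at key
        have h5 := congrFun (congrFun key s) u
        simp at h5
      refine ⟨?_, hab, ?_⟩
      · rw [← hAB s t u]
        exact heq
      · rw [key, smul_smul, inv_mul_cancel₀ hab, one_smul]
    · exfalso
      have h3 : γ (phi ρV v (q t / p s) * phi ρV v (r u / q t)) = 0 := by
        have h4 := hJ (phi ρV v (q t / p s) * phi ρV v (r u / q t)) 0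
          (by rw [sub_zero]; exact phi_mul_mem hinj hlt)
        rwa [map_zero] at h4
      have key : Matrix.single s u (1 : ℂ) = 0 := by rw [← h1, h2, h3, smul_zero]
      have h5 := congrFun (congrFun key s) u
      simp at h5
  -- cross products whose weight is an output weight are not additive in level
  have hcross : ∀ s₁ t₁ u₁ s₂ t₂ u₂, t₁ ≠ t₂ → q t₁ / p s₁ * (r u₂ / q t₂) = r u₁ / p s₂ →
      lev ρV v (r u₁ / p s₂) ≠ lev ρV v (q t₁ / p s₁) + lev ρV v (r u₂ / q t₂) := by
    intro s₁ t₁ u₁ s₂ t₂ u₂ ht hABC heq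
    have h1 : γ (α (Matrix.single s₁ t₁ 1) * β (Matrix.single t₂ u₂ 1)) = 0 := by
      rw [hhost, Matrix.single_mul_single_of_ne _ _ _ _ ht]
    have h2 := hprod s₁ t₁ t₂ u₂
    have h3 : γ (phi ρV v (q t₁ / p s₁) * phi ρV v (r u₂ / q t₂)) =
        γ (phi ρV v (r u₁ / p s₂)) := by
      apply hJ
      have h4 := phi_mul_sub_phi_mem hinj (χ := q t₁ / p s₁) (ψ := r u₂ / q t₂)
        (by rw [hABC]; exact heq)
      rwa [hABC] at h4
    obtain ⟨-, hab₁, -⟩ := hmatch s₁ t₁ u₁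
    obtain ⟨-, hab₂, -⟩ := hmatch s₂ t₂ u₂
    obtain ⟨-, hab₃, hγC⟩ := hmatch s₂ t₁ u₁
    rw [h2, h3, hγC, smul_smul] at h1
    have hc : a s₁ t₁ * b t₂ u₂ * (a s₂ t₁ * b t₁ u₁)⁻¹ ≠ 0 :=
      mul_ne_zero (mul_ne_zero (left_ne_zero_of_mul hab₁) (right_ne_zero_of_mul hab₂))
        (inv_ne_zero hab₃)
    rcases smul_eq_zero.1 h1 with h4 | h4
    · exact hc h4
    · have h5 := congrFun (congrFun h4 s₂) u₁
      simp at h5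
  -- output weights are distinct
  have hCinj : ∀ s₁ u₁ s₂ u₂, r u₁ / p s₁ = r u₂ / p s₂ → s₁ = s₂ ∧ u₁ = u₂ := by
    intro s₁ u₁ s₂ u₂ h
    obtain ⟨-, hab₁, h₁⟩ := hmatch s₁ s₁ u₁
    obtain ⟨-, hab₂, h₂⟩ := hmatch s₂ s₁ u₂
    rw [h, h₂] at h₁
    have h3 := congrFun (congrFun h₁ s₁) u₁
    by_contra hne
    have hne' : ¬(s₂ = s₁ ∧ u₂ = u₁) := fun h' => hne ⟨h'.1.symm, h'.2.symm⟩
    simp [hne'] at h3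
    rcases h3 with h3 | h3 <;> exact hab₁ (by simp [h3])
  -- the combinatorial core: `(s,t,u) ↦ q_t/(p_s r_u)` is injective
  have hΨ := psi_injective (Λ := Additive (Γ →* ℂˣ)) (fun x => lev ρV v (Additive.toMul x))
    (fun s => Additive.ofMul (p s)) (fun t => Additive.ofMul (q t)) (fun u => Additive.ofMul (r u))
    (fun χ ψ => by simpa using lev_mul_le hinj (Additive.toMul χ) (Additive.toMul ψ))
    (fun s t u => by simpa using (hmatch s t u).1)
    (fun s₁ t₁ u₁ s₂ t₂ u₂ ht h => by
      simpa using hcross s₁ t₁ u₁ s₂ t₂ u₂ ht (by simpa using congrArg Additive.toMul h))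
    (fun s₁ u₁ s₂ u₂ h => hCinj s₁ u₁ s₂ u₂ (by simpa using congrArg Additive.toMul h))
  -- count: distinct characters are linearly independent functions on `Γ`
  let Ψ : Fin N × Fin N × Fin N → (Γ →* ℂ) := fun stu =>
    (Units.coeHom ℂ).comp (q stu.2.1 / p stu.1 / r stu.2.2)
  have hΨinj : Function.Injective Ψ := by
    intro x y hxy
    apply hΨ
    have hq : q x.2.1 / p x.1 / r x.2.2 = q y.2.1 / p y.1 / r y.2.2 := by
      ext g
      have h := DFunLike.congr_fun hxy g
      simpa [Ψ] using h
    simpa using congrArg Additive.ofMul hq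
  have hli := (linearIndependent_monoidHom Γ ℂ).comp Ψ hΨinj
  have hcard := hli.fintype_card_le_finrank
  simp only [Fintype.card_prod, Fintype.card_fin, Module.finrank_fintype_fun_eq_card] at hcard
  calc N ^ 3 = N * (N * N) := by ring
    _ ≤ Fintype.card Γ := hcard

end AbelianNoGo

open AbelianNoGo in
/-- **Abelian no-go** (settles `stmt-MatrixMultiplication-5456`, exact route signature
`Summit.MatrixMultiplication.MatrixMultiplication.Theses.OrbitHarmonicsHosts.AbelianNoGo`):
for a finite abelian group `Γ`, a free orbit `Γ·v ⊂ ℂ^d` and a `Γ`-equivariant hosting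
`γ(α(X) β(Y)) = X Y` of `N × N` matrix multiplication in the orbit-harmonics ring
`ℂ[x]/span LF(I(Γ·v))`, one has `N³ ≤ |Γ|`.  Simultaneously diagonalise `ρ_P, ρ_Q, ρ_R`
(`exists_diagonalizer`), conjugate `α, β, γ` by the base changes, and apply the diagonal case
`pow_three_le_card_of_diagonal`. [folklore] -/
theorem AbelianNoGo_proof :
    Summit.MatrixMultiplication.MatrixMultiplication.Theses.OrbitHarmonicsHosts.AbelianNoGo := by
  intro Γ _ _ d N ρV v ρP ρQ ρR α β γ hinj hγ hhost hα hβ _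
  classical
  obtain ⟨SP, TP, p, hTSP, hSTP, hDP⟩ := exists_diagonalizer ρP
  obtain ⟨SQ, TQ, q, hTSQ, hSTQ, hDQ⟩ := exists_diagonalizer ρQ
  obtain ⟨SR, TR, r, hTSR, hSTR, hDR⟩ := exists_diagonalizer ρR
  -- `ρ(g⁻¹) S = S D(g⁻¹)` and `T ρ(g) = D(g) T`
  have left_eq : ∀ (ρ : Γ →* GL (Fin N) ℂ) (S T : Matrix (Fin N) (Fin N) ℂ) (c : Fin N → (Γ →* ℂˣ)),
      S * T = 1 → (∀ g, T * (ρ g : Matrix (Fin N) (Fin N) ℂ) * S =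
        Matrix.diagonal fun s => ((c s g : ℂˣ) : ℂ)) →
      ∀ g, (ρ g⁻¹ : Matrix (Fin N) (Fin N) ℂ) * S =
        S * Matrix.diagonal fun s => ((c s g : ℂˣ) : ℂ)⁻¹ := by
    intro ρ S T c hST hD g
    have e : (Matrix.diagonal fun s => ((c s g : ℂˣ) : ℂ)⁻¹) =
        Matrix.diagonal fun s => ((c s g⁻¹ : ℂˣ) : ℂ) := by
      congr 1
      funext s
      simp
    rw [e, ← hD g⁻¹, ← Matrix.mul_assoc, ← Matrix.mul_assoc, hST, Matrix.one_mul]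
  have right_eq : ∀ (ρ : Γ →* GL (Fin N) ℂ) (S T : Matrix (Fin N) (Fin N) ℂ) (c : Fin N → (Γ →* ℂˣ)),
      S * T = 1 → (∀ g, T * (ρ g : Matrix (Fin N) (Fin N) ℂ) * S =
        Matrix.diagonal fun s => ((c s g : ℂˣ) : ℂ)) →
      ∀ g, T * (ρ g : Matrix (Fin N) (Fin N) ℂ) =
        (Matrix.diagonal fun s => ((c s g : ℂˣ) : ℂ)) * T := by
    intro ρ S T c hST hD g
    rw [← hD g, Matrix.mul_assoc (T * (ρ g : Matrix (Fin N) (Fin N) ℂ)), hST, Matrix.mul_one]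
  -- the conjugated hosting maps
  let α' : Matrix (Fin N) (Fin N) ℂ → MvPolynomial (Fin d) ℂ := fun X => α (SP * X * TQ)
  let β' : Matrix (Fin N) (Fin N) ℂ → MvPolynomial (Fin d) ℂ := fun Y => β (SQ * Y * TR)
  let γ' : MvPolynomial (Fin d) ℂ →ₗ[ℂ] Matrix (Fin N) (Fin N) ℂ :=
    (LinearMap.mulLeft ℂ TP ∘ₗ LinearMap.mulRight ℂ SR) ∘ₗ γ
  have hγ' : ∀ f, γ' f = TP * (γ f * SR) := fun f => rfl
  refine pow_three_le_card_of_diagonal ρV v hinj p q r α' β' γ' ?_ ?_ ?_ ?_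
  · intro f hf
    rw [hγ', hγ f hf, Matrix.zero_mul, Matrix.mul_zero]
  · intro s t t' u
    simp only [α', β', hγ', hhost]
    have k1 : ∀ Z : Matrix (Fin N) (Fin N) ℂ, TQ * (SQ * Z) = Z := fun Z => by
      rw [← Matrix.mul_assoc, hTSQ, Matrix.one_mul]
    have k2 : ∀ Z : Matrix (Fin N) (Fin N) ℂ, TP * (SP * Z) = Z := fun Z => by
      rw [← Matrix.mul_assoc, hTSP, Matrix.one_mul]
    simp only [Matrix.mul_assoc, k1, k2, hTSR, Matrix.mul_one]
  · intro g s t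
    have e3 : (ρP g⁻¹ : Matrix (Fin N) (Fin N) ℂ) * (SP * Matrix.single s t 1 * TQ) *
        (ρQ g : Matrix (Fin N) (Fin N) ℂ) = SP * (fn (q t / p s) g • Matrix.single s t 1) * TQ := by
      calc (ρP g⁻¹ : Matrix (Fin N) (Fin N) ℂ) * (SP * Matrix.single s t 1 * TQ) *
            (ρQ g : Matrix (Fin N) (Fin N) ℂ)
          = (ρP g⁻¹ : Matrix (Fin N) (Fin N) ℂ) * SP * Matrix.single s t 1 *
              (TQ * (ρQ g : Matrix (Fin N) (Fin N) ℂ)) := by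
            simp only [Matrix.mul_assoc]
        _ = SP * ((Matrix.diagonal fun s => ((p s g : ℂˣ) : ℂ)⁻¹) * Matrix.single s t 1 *
              Matrix.diagonal fun t => ((q t g : ℂˣ) : ℂ)) * TQ := by
            rw [left_eq ρP SP TP p hSTP hDP g, right_eq ρQ SQ TQ q hSTQ hDQ g]
            simp only [Matrix.mul_assoc]
        _ = SP * (fn (q t / p s) g • Matrix.single s t 1) * TQ := by
            rw [diagonal_mul_single_mul_diagonal, Matrix.smul_single]
            congr 3
            simp [fn, div_eq_mul_inv, mul_comm]
    show subst ρV g (α (SP * Matrix.single s t 1 * TQ)) =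
      fn (q t / p s) g • α (SP * Matrix.single s t 1 * TQ)
    rw [show subst ρV g (α (SP * Matrix.single s t 1 * TQ)) =
        α ((ρP g⁻¹ : Matrix (Fin N) (Fin N) ℂ) * (SP * Matrix.single s t 1 * TQ) *
          (ρQ g : Matrix (Fin N) (Fin N) ℂ)) from (hα g _).symm, e3, Matrix.mul_smul,
      Matrix.smul_mul, map_smul]
  · intro g t u
    have e3 : (ρQ g⁻¹ : Matrix (Fin N) (Fin N) ℂ) * (SQ * Matrix.single t u 1 * TR) *
        (ρR g : Matrix (Fin N) (Fin N) ℂ) = SQ * (fn (r u / q t) g • Matrix.single t u 1) * TR := by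
      calc (ρQ g⁻¹ : Matrix (Fin N) (Fin N) ℂ) * (SQ * Matrix.single t u 1 * TR) *
            (ρR g : Matrix (Fin N) (Fin N) ℂ)
          = (ρQ g⁻¹ : Matrix (Fin N) (Fin N) ℂ) * SQ * Matrix.single t u 1 *
              (TR * (ρR g : Matrix (Fin N) (Fin N) ℂ)) := by
            simp only [Matrix.mul_assoc]
        _ = SQ * ((Matrix.diagonal fun t => ((q t g : ℂˣ) : ℂ)⁻¹) * Matrix.single t u 1 *
              Matrix.diagonal fun u => ((r u g : ℂˣ) : ℂ)) * TR := by
            rw [left_eq ρQ SQ TQ q hSTQ hDQ g, right_eq ρR SR TR r hSTR hDR g]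
            simp only [Matrix.mul_assoc]
        _ = SQ * (fn (r u / q t) g • Matrix.single t u 1) * TR := by
            rw [diagonal_mul_single_mul_diagonal, Matrix.smul_single]
            congr 3
            simp [fn, div_eq_mul_inv, mul_comm]
    show subst ρV g (β (SQ * Matrix.single t u 1 * TR)) =
      fn (r u / q t) g • β (SQ * Matrix.single t u 1 * TR)
    rw [show subst ρV g (β (SQ * Matrix.single t u 1 * TR)) =
        β ((ρQ g⁻¹ : Matrix (Fin N) (Fin N) ℂ) * (SQ * Matrix.single t u 1 * TR) *
          (ρR g : Matrix (Fin N) (Fin N) ℂ)) from (hβ g _).symm, e3, Matrix.mul_smul,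
      Matrix.smul_mul, map_smul]

end Summit.MatrixMultiplication.MatrixMultiplication.Theorems
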